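import Summits.BirchSwinnertonDyer.Rank1Residual.P2.KrizLiJZeroBasesMembership
import Summits.BirchSwinnertonDyer.Rank1Residual.P2.KrizLiMordellBasesMembership
import Literature.NumberTheory.EllipticCurves.Rank1Residual.CornerFTwoCertificates.KrizLiSchema
import HarnessLib

/-!
# Cell `bsd-print-cf2` (D-0131 (2) PRINT TIER, leaf CornerF @ `p = 2`), seat ty3 — display glue for the
# Kriz–Li twist-family certificate records at the seven (★)-CERTIFIED `j = 0` bases `1323a1`, `1323m1`
# (`K = ℚ(√−47)`), `4563a1`, `972d1`, `3888s1`, `1728a1`, `1728v1` (`K = ℚ(√−23)`): every CERTIFIED record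
# is a member of the generic Kriz–Li door (aside 21366) BY NAME, the (★)-datum DISPLAYED

HONEST FRAMING (cell `bsd-print-cf2`, run/shared/lean/pub/bsd-print-cf2/; verbatim): PARTITION currency
only — the leaf counts when its class theorem is in the kernel BY NAME; every imported theorem carries its
printed hypotheses verbatim. The leaf is OPEN AS A CLASS; nothing class-wide is closed here; theorems
only, no definition, no named fact. Companion of `P2/CornerFTwoCertificatesKrizLi.lean` (the PRINTED fibre
`(243a1, ℚ(√−23))`) for the OTHER bases of the cell's Kriz–Li (★)-door (aside 21366
`InertKrizLiStarDoorOfFactsPlus`, p3's `bsdp_two_of_isIsogenousToKrizLiTwistOfSmallCMBase`; ty2 g3's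
per-base settings and membership packaging `isIsogenousToKrizLiTwistOfSmallCMBase_of_curveX_of_discr_eq` +
`inN_curveX_of_explicit`). At these bases Assumption (★) is NOT printed: it is the lit seat's exact
certificate (HOME/lit/census-g5/; ty3's `RecordsStarJZero{Good,Bad}.lean`) and enters every theorem below
as the DISPLAYED hypothesis `hSD : HasKrizLiStarDatum curveX (sqrtField D)` — currency
LITERAL-by-name((★)-certificate). For a record `r` of a `KLCertified` list (schema `KrizLiSchema.lean`)
with base data `(d_K, c, badPrimes) = (D_X, c_X, bad_X)`: the recheck decided `0 < d ≡ 1 (mod 12)`, `d`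
square-free and every prime of `d` SILENT for `(D_X, c_X, bad_X)`; §1 turns that into ty2's explicit
membership `d ∈ 𝒩(X, ℚ(√D_X))`, and §2 concludes `BSD(W′, 2)` for every globally minimal `W′`
`ℚ`-isogenous to `X^{(d)}` or `X^{(d·D_X)}`, granted p3's seven binders `hKL h33 hS31 hBF hmod hGZK hCassels`
and `hSD`. Base data: `1323a1 = cubicA₃ 600`: `(−47, −16·(4·600+1) = −38416, [2,3,7])`; `1323m1 =
cubicA₃ (−2)`: `(−47, 112, [2,3,7])`; `4563a1 = cubicA₃ 92823`: `(−23, −5940688, [2,3,13])`;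
`972d1 : y² = x³ + 36`: `(−23, −36, [2,3])`; `3888s1 : y² = x³ + 48`: `(−23, −48, [2,3])`;
`1728a1 : y² = x³ + 2`: `(−23, −2, [2,3])`; `1728v1 : y² = x³ − 2`: `(−23, 2, [2,3])`.
beyond-print theorem: NO (display glue). [cite: KrizLi2019, Thm. 1.12 (FMS Thm. 5.1 (2)), Def. 4.1, §6 Ex. 6.2 and Rem. 6.3]

References: [KrizLi2019] Thm 1.12, Thm 4.3, Def 4.1, §6; [CreutzMiller2012] Thm 1.1; [BurungaleFlach2024]
Cor 2; [MilneADT2006] Thm I.7.3; [Miller2011LMS] Def 1.1.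
-/

noncomputable section

open scoped Classical

open WeierstrassCurve NumberField Literature.NumberTheory.EllipticCurves
  Literature.NumberTheory.EllipticCurves.Rank1Residual
  Literature.NumberTheory.EllipticCurves.ModularForms
  Literature.NumberTheory.EllipticCurves.Rank1Residual.CornerFTwoCertificates
  Summit.BirchSwinnertonDyer.Rank1Residual

set_option autoImplicit false

namespace Summit.BirchSwinnertonDyer.Rank1Residual.P2

/-! ## §1 Decoding a certified record at base data `(D, c, bad)` into ty2's explicit membership hypotheses -/

/-- A certified Kriz–Li record with base data `(D, c, bad)`, `2 ∈ bad`, decoded: `0 < d`, `d ≡ 1 (mod 12)`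
(so `d ≡ 1 (mod 4)`), `d` square-free, and every prime `ℓ ∣ d` is `∉ bad`, prime to `D`, split in
`ℚ(√D)` (`(D/ℓ) = 1`) with an even number of roots of `x³ = c` in `𝔽_ℓ` — the shape of ty2's
`inN_curveX_of_explicit`. [cite: KrizLi2019, Def. 4.1 (FMS) = arXiv Def. 3.1] -/
theorem klExplicit_of_check {r : KLRecord} (h : r.check = true) {D c : ℤ} {bad : List ℕ}
    (hD : r.fieldDisc = D) (hc : r.cubeConst = c) (hb : r.badPrimes = bad) (h2 : 2 ∈ bad) :
    (0 : ℤ) < (r.d : ℤ) ∧ (r.d : ℤ) % 12 = 1 ∧ (r.d : ℤ) % 4 = 1 ∧ Squarefree (r.d : ℤ).natAbs ∧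
      ∀ (ℓ : ℕ) (hℓ : ℓ.Prime), ℓ ∣ (r.d : ℤ).natAbs →
        ℓ ∉ bad ∧ ¬ ℓ ∣ D.natAbs ∧ jacobiSym D ℓ = 1 ∧
          (haveI : NeZero ℓ := ⟨hℓ.ne_zero⟩;
            Even ((Finset.univ.filter fun x : ZMod ℓ => x ^ 3 = (c : ZMod ℓ)).card)) := by
  obtain ⟨hpos, h12, hsq, -, -, hsil⟩ := r.hyps_of_check h
  refine ⟨by exact_mod_cast hpos, by exact_mod_cast h12, by omega, by simpa using hsq, fun ℓ hℓ hℓd => ?_⟩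
  have hℓd' : ℓ ∣ r.d := by simpa using hℓd
  have hs := (hsil ℓ hℓ hℓd').2
  rw [hD, hc, hb] at hs
  obtain ⟨-, hbad, hdvd, hj, hev⟩ := silent_of_silentBit h2 hs
  haveI : NeZero ℓ := ⟨hℓ.ne_zero⟩
  exact ⟨hbad, hdvd, hj, hev⟩

/-! ## §2 `BSD(W′, 2)` by name for every certified record, base by base -/

/-- **Base `1323a1 = cubicA₃ 600` over `K = ℚ(√−47)`** ((★) CERTIFIED, displayed as `hSD`): for every record
of a certified list with base data `(−47, −38416, [2,3,7])`, `BSD(W′, 2)` for every globally minimal `W′`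
`ℚ`-isogenous to `1323a1^{(d)}` or `1323a1^{(−47d)}`. [cite: KrizLi2019, Thm. 5.1 (2), Def. 4.1 and §6 Ex. 6.2]
[cite: CreutzMiller2012, Thm. 1.1] [cite: BurungaleFlach2024, Thm. 1.1 and Cor. 2] [cite: MilneADT2006, Thm. I.7.3] -/
theorem bsdp_two_of_klCertified_1323a1 (hKL : KrizLi2019.thm112_bsdTwo_twist)
    (h33 : KrizLi2019.thm33_rank_twist) (hS31 : bsdTriple_of_analyticRank_le_one_of_conductor_lt)
    (hBF : bsdTriple_of_hasCM_of_L_one_ne_zero) (hmod : hasEntireLFunction_rat)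
    (hGZK : rank_eq_analyticRank_of_analyticRank_le_one) (hCassels : bsdRHS_eq_of_isIsogenous)
    (hSD : HasKrizLiStarDatum curve1323a1 (sqrtField (-47)))
    {rs : List KLRecord} (h : KLCertified rs) :
    ∀ r ∈ rs, r.fieldDisc = -47 → r.cubeConst = -38416 → r.badPrimes = [2, 3, 7] →
      ∀ (W' : WeierstrassCurve ℚ) [W'.IsElliptic] [W'.IsGloballyMinimal],
        (IsIsogenous W' (curve1323a1.quadraticTwist ((r.d : ℤ) : ℚ)) ∨
          IsIsogenous W' (curve1323a1.quadraticTwist ((-47 * (r.d : ℤ) : ℤ) : ℚ))) → BSDp W' 2 := by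
  intro r hr hD hc hb W' _ _ hiso
  obtain ⟨hd0, hd12, hd4, hsq, hP⟩ := klExplicit_of_check (h.check_of_mem hr) hD hc hb (by simp)
  obtain ⟨hK, hdK⟩ := isImaginaryQuadratic_and_discr_sqrtField_neg_fortySeven
  have hIn : KrizLi2019.InN curve1323a1 (sqrtField (-47)) (r.d : ℤ) :=
    inN_curve1323a1_of_explicit (sqrtField.finrank_eq_two (-47)) hd4 hsq fun ℓ hℓ hℓd => by
      obtain ⟨hbad, -, hj, hev⟩ := hP ℓ hℓ hℓd
      refine ⟨fun e => hbad (by simp [e]), fun e => hbad (by simp [e]), fun e => hbad (by simp [e]),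
        by rw [hdK]; exact hj, ?_⟩
      have e : ((-38416 : ℤ) : ZMod ℓ) = -(16 * (4 * (600 : ZMod ℓ) + 1)) := by push_cast; norm_num
      rw [← e]; exact hev
  have hqd : ¬ (7 : ℤ) ∣ (r.d : ℤ) := fun h7 =>
    (hP 7 (by norm_num) (Int.natCast_dvd.mp (by exact_mod_cast h7))).1 (by simp)
  exact bsdp_two_of_isIsogenousToKrizLiTwistOfSmallCMBase hKL h33 hS31 hBF hmod hGZK hCassels W'
    (isIsogenousToKrizLiTwistOfSmallCMBase_of_curve1323a1_of_discr_eq hK hdK hSD hIn hd0 hd12 hqd hiso)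

/-- **Base `1323m1 = cubicA₃ (−2)` over `K = ℚ(√−47)`** ((★) CERTIFIED, displayed as `hSD`): base data
`(−47, 112, [2,3,7])`. [cite: KrizLi2019, Thm. 5.1 (2), Def. 4.1 and §6 Ex. 6.2] [cite: CreutzMiller2012, Thm. 1.1]
[cite: BurungaleFlach2024, Thm. 1.1 and Cor. 2] [cite: MilneADT2006, Thm. I.7.3] -/
theorem bsdp_two_of_klCertified_1323m1 (hKL : KrizLi2019.thm112_bsdTwo_twist)
    (h33 : KrizLi2019.thm33_rank_twist) (hS31 : bsdTriple_of_analyticRank_le_one_of_conductor_lt)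
    (hBF : bsdTriple_of_hasCM_of_L_one_ne_zero) (hmod : hasEntireLFunction_rat)
    (hGZK : rank_eq_analyticRank_of_analyticRank_le_one) (hCassels : bsdRHS_eq_of_isIsogenous)
    (hSD : HasKrizLiStarDatum curve1323m1 (sqrtField (-47)))
    {rs : List KLRecord} (h : KLCertified rs) :
    ∀ r ∈ rs, r.fieldDisc = -47 → r.cubeConst = 112 → r.badPrimes = [2, 3, 7] →
      ∀ (W' : WeierstrassCurve ℚ) [W'.IsElliptic] [W'.IsGloballyMinimal],
        (IsIsogenous W' (curve1323m1.quadraticTwist ((r.d : ℤ) : ℚ)) ∨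
          IsIsogenous W' (curve1323m1.quadraticTwist ((-47 * (r.d : ℤ) : ℤ) : ℚ))) → BSDp W' 2 := by
  intro r hr hD hc hb W' _ _ hiso
  obtain ⟨hd0, hd12, hd4, hsq, hP⟩ := klExplicit_of_check (h.check_of_mem hr) hD hc hb (by simp)
  obtain ⟨hK, hdK⟩ := isImaginaryQuadratic_and_discr_sqrtField_neg_fortySeven
  have hIn : KrizLi2019.InN curve1323m1 (sqrtField (-47)) (r.d : ℤ) :=
    inN_curve1323m1_of_explicit (sqrtField.finrank_eq_two (-47)) hd4 hsq fun ℓ hℓ hℓd => by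
      obtain ⟨hbad, -, hj, hev⟩ := hP ℓ hℓ hℓd
      refine ⟨fun e => hbad (by simp [e]), fun e => hbad (by simp [e]), fun e => hbad (by simp [e]),
        by rw [hdK]; exact hj, ?_⟩
      have e : ((112 : ℤ) : ZMod ℓ) = -(16 * (4 * (-2 : ZMod ℓ) + 1)) := by push_cast; norm_num
      rw [← e]; exact hev
  have hqd : ¬ (7 : ℤ) ∣ (r.d : ℤ) := fun h7 =>
    (hP 7 (by norm_num) (Int.natCast_dvd.mp (by exact_mod_cast h7))).1 (by simp)
  exact bsdp_two_of_isIsogenousToKrizLiTwistOfSmallCMBase hKL h33 hS31 hBF hmod hGZK hCassels W'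
    (isIsogenousToKrizLiTwistOfSmallCMBase_of_curve1323m1_of_discr_eq hK hdK hSD hIn hd0 hd12 hqd hiso)

/-- **Base `4563a1 = cubicA₃ 92823` over `K = ℚ(√−23)`** ((★) CERTIFIED, displayed as `hSD`): base data
`(−23, −5940688, [2,3,13])`. [cite: KrizLi2019, Thm. 5.1 (2), Def. 4.1 and §6 Ex. 6.2] [cite: CreutzMiller2012, Thm. 1.1]
[cite: BurungaleFlach2024, Thm. 1.1 and Cor. 2] [cite: MilneADT2006, Thm. I.7.3] -/
theorem bsdp_two_of_klCertified_4563a1 (hKL : KrizLi2019.thm112_bsdTwo_twist)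
    (h33 : KrizLi2019.thm33_rank_twist) (hS31 : bsdTriple_of_analyticRank_le_one_of_conductor_lt)
    (hBF : bsdTriple_of_hasCM_of_L_one_ne_zero) (hmod : hasEntireLFunction_rat)
    (hGZK : rank_eq_analyticRank_of_analyticRank_le_one) (hCassels : bsdRHS_eq_of_isIsogenous)
    (hSD : HasKrizLiStarDatum curve4563a1 (sqrtField (-23)))
    {rs : List KLRecord} (h : KLCertified rs) :
    ∀ r ∈ rs, r.fieldDisc = -23 → r.cubeConst = -5940688 → r.badPrimes = [2, 3, 13] →
      ∀ (W' : WeierstrassCurve ℚ) [W'.IsElliptic] [W'.IsGloballyMinimal],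
        (IsIsogenous W' (curve4563a1.quadraticTwist ((r.d : ℤ) : ℚ)) ∨
          IsIsogenous W' (curve4563a1.quadraticTwist ((-23 * (r.d : ℤ) : ℤ) : ℚ))) → BSDp W' 2 := by
  intro r hr hD hc hb W' _ _ hiso
  obtain ⟨hd0, hd12, hd4, hsq, hP⟩ := klExplicit_of_check (h.check_of_mem hr) hD hc hb (by simp)
  obtain ⟨hK, hdK⟩ := isImaginaryQuadratic_and_discr_sqrtField_neg_twentyThree
  have hIn : KrizLi2019.InN curve4563a1 (sqrtField (-23)) (r.d : ℤ) :=
    inN_curve4563a1_of_explicit (sqrtField.finrank_eq_two (-23)) hd4 hsq fun ℓ hℓ hℓd => by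
      obtain ⟨hbad, -, hj, hev⟩ := hP ℓ hℓ hℓd
      refine ⟨fun e => hbad (by simp [e]), fun e => hbad (by simp [e]), fun e => hbad (by simp [e]),
        by rw [hdK]; exact hj, ?_⟩
      have e : ((-5940688 : ℤ) : ZMod ℓ) = -(16 * (4 * (92823 : ZMod ℓ) + 1)) := by push_cast; norm_num
      rw [← e]; exact hev
  have hqd : ¬ (13 : ℤ) ∣ (r.d : ℤ) := fun h13 =>
    (hP 13 (by norm_num) (Int.natCast_dvd.mp (by exact_mod_cast h13))).1 (by simp)
  exact bsdp_two_of_isIsogenousToKrizLiTwistOfSmallCMBase hKL h33 hS31 hBF hmod hGZK hCassels W'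
    (isIsogenousToKrizLiTwistOfSmallCMBase_of_curve4563a1_of_discr_eq hK hdK hSD hIn hd0 hd12 hqd hiso)

/-- **Base `972d1 : y² = x³ + 36` over `K = ℚ(√−23)`** ((★) CERTIFIED, displayed as `hSD`; additive at `2`,
Manin clause inside `hSD`): base data `(−23, −36, [2,3])`. [cite: KrizLi2019, Thm. 5.1 (2), Def. 4.1 and §6 Ex. 6.2]
[cite: CreutzMiller2012, Thm. 1.1] [cite: BurungaleFlach2024, Thm. 1.1 and Cor. 2] [cite: MilneADT2006, Thm. I.7.3] -/
theorem bsdp_two_of_klCertified_972d1 (hKL : KrizLi2019.thm112_bsdTwo_twist)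
    (h33 : KrizLi2019.thm33_rank_twist) (hS31 : bsdTriple_of_analyticRank_le_one_of_conductor_lt)
    (hBF : bsdTriple_of_hasCM_of_L_one_ne_zero) (hmod : hasEntireLFunction_rat)
    (hGZK : rank_eq_analyticRank_of_analyticRank_le_one) (hCassels : bsdRHS_eq_of_isIsogenous)
    (hSD : HasKrizLiStarDatum curve972d1 (sqrtField (-23)))
    {rs : List KLRecord} (h : KLCertified rs) :
    ∀ r ∈ rs, r.fieldDisc = -23 → r.cubeConst = -36 → r.badPrimes = [2, 3] →
      ∀ (W' : WeierstrassCurve ℚ) [W'.IsElliptic] [W'.IsGloballyMinimal],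
        (IsIsogenous W' (curve972d1.quadraticTwist ((r.d : ℤ) : ℚ)) ∨
          IsIsogenous W' (curve972d1.quadraticTwist ((-23 * (r.d : ℤ) : ℤ) : ℚ))) → BSDp W' 2 := by
  intro r hr hD hc hb W' _ _ hiso
  obtain ⟨hd0, hd12, hd4, hsq, hP⟩ := klExplicit_of_check (h.check_of_mem hr) hD hc hb (by simp)
  obtain ⟨hK, hdK⟩ := isImaginaryQuadratic_and_discr_sqrtField_neg_twentyThree
  have hIn : KrizLi2019.InN curve972d1 (sqrtField (-23)) (r.d : ℤ) :=
    inN_curve972d1_of_explicit (sqrtField.finrank_eq_two (-23)) hd4 hsq fun ℓ hℓ hℓd => by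
      obtain ⟨hbad, -, hj, hev⟩ := hP ℓ hℓ hℓd
      refine ⟨fun e => hbad (by simp [e]), fun e => hbad (by simp [e]), by rw [hdK]; exact hj, ?_⟩
      have e : ((-36 : ℤ) : ZMod ℓ) = -36 := by push_cast; norm_num
      rw [← e]; exact hev
  exact bsdp_two_of_isIsogenousToKrizLiTwistOfSmallCMBase hKL h33 hS31 hBF hmod hGZK hCassels W'
    (isIsogenousToKrizLiTwistOfSmallCMBase_of_curve972d1_of_discr_eq hK hdK hSD hIn hd0 hd12 hiso)

/-- **Base `3888s1 : y² = x³ + 48` over `K = ℚ(√−23)`** ((★) CERTIFIED, displayed as `hSD`; additive at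
`2`): base data `(−23, −48, [2,3])`. [cite: KrizLi2019, Thm. 5.1 (2), Def. 4.1 and §6 Ex. 6.2]
[cite: CreutzMiller2012, Thm. 1.1] [cite: BurungaleFlach2024, Thm. 1.1 and Cor. 2] [cite: MilneADT2006, Thm. I.7.3] -/
theorem bsdp_two_of_klCertified_3888s1 (hKL : KrizLi2019.thm112_bsdTwo_twist)
    (h33 : KrizLi2019.thm33_rank_twist) (hS31 : bsdTriple_of_analyticRank_le_one_of_conductor_lt)
    (hBF : bsdTriple_of_hasCM_of_L_one_ne_zero) (hmod : hasEntireLFunction_rat)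
    (hGZK : rank_eq_analyticRank_of_analyticRank_le_one) (hCassels : bsdRHS_eq_of_isIsogenous)
    (hSD : HasKrizLiStarDatum curve3888s1 (sqrtField (-23)))
    {rs : List KLRecord} (h : KLCertified rs) :
    ∀ r ∈ rs, r.fieldDisc = -23 → r.cubeConst = -48 → r.badPrimes = [2, 3] →
      ∀ (W' : WeierstrassCurve ℚ) [W'.IsElliptic] [W'.IsGloballyMinimal],
        (IsIsogenous W' (curve3888s1.quadraticTwist ((r.d : ℤ) : ℚ)) ∨
          IsIsogenous W' (curve3888s1.quadraticTwist ((-23 * (r.d : ℤ) : ℤ) : ℚ))) → BSDp W' 2 := by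
  intro r hr hD hc hb W' _ _ hiso
  obtain ⟨hd0, hd12, hd4, hsq, hP⟩ := klExplicit_of_check (h.check_of_mem hr) hD hc hb (by simp)
  obtain ⟨hK, hdK⟩ := isImaginaryQuadratic_and_discr_sqrtField_neg_twentyThree
  have hIn : KrizLi2019.InN curve3888s1 (sqrtField (-23)) (r.d : ℤ) :=
    inN_curve3888s1_of_explicit (sqrtField.finrank_eq_two (-23)) hd4 hsq fun ℓ hℓ hℓd => by
      obtain ⟨hbad, -, hj, hev⟩ := hP ℓ hℓ hℓd
      refine ⟨fun e => hbad (by simp [e]), fun e => hbad (by simp [e]), by rw [hdK]; exact hj, ?_⟩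
      have e : ((-48 : ℤ) : ZMod ℓ) = -48 := by push_cast; norm_num
      rw [← e]; exact hev
  exact bsdp_two_of_isIsogenousToKrizLiTwistOfSmallCMBase hKL h33 hS31 hBF hmod hGZK hCassels W'
    (isIsogenousToKrizLiTwistOfSmallCMBase_of_curve3888s1_of_discr_eq hK hdK hSD hIn hd0 hd12 hiso)

/-- **Base `1728a1 : y² = x³ + 2` over `K = ℚ(√−23)`** ((★) CERTIFIED, displayed as `hSD`; additive at `2`):
base data `(−23, −2, [2,3])`. [cite: KrizLi2019, Thm. 5.1 (2), Def. 4.1 and §6 Ex. 6.2]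
[cite: CreutzMiller2012, Thm. 1.1] [cite: BurungaleFlach2024, Thm. 1.1 and Cor. 2] [cite: MilneADT2006, Thm. I.7.3] -/
theorem bsdp_two_of_klCertified_1728a1 (hKL : KrizLi2019.thm112_bsdTwo_twist)
    (h33 : KrizLi2019.thm33_rank_twist) (hS31 : bsdTriple_of_analyticRank_le_one_of_conductor_lt)
    (hBF : bsdTriple_of_hasCM_of_L_one_ne_zero) (hmod : hasEntireLFunction_rat)
    (hGZK : rank_eq_analyticRank_of_analyticRank_le_one) (hCassels : bsdRHS_eq_of_isIsogenous)
    (hSD : HasKrizLiStarDatum curve1728a1 (sqrtField (-23)))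
    {rs : List KLRecord} (h : KLCertified rs) :
    ∀ r ∈ rs, r.fieldDisc = -23 → r.cubeConst = -2 → r.badPrimes = [2, 3] →
      ∀ (W' : WeierstrassCurve ℚ) [W'.IsElliptic] [W'.IsGloballyMinimal],
        (IsIsogenous W' (curve1728a1.quadraticTwist ((r.d : ℤ) : ℚ)) ∨
          IsIsogenous W' (curve1728a1.quadraticTwist ((-23 * (r.d : ℤ) : ℤ) : ℚ))) → BSDp W' 2 := by
  intro r hr hD hc hb W' _ _ hiso
  obtain ⟨hd0, hd12, hd4, hsq, hP⟩ := klExplicit_of_check (h.check_of_mem hr) hD hc hb (by simp)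
  obtain ⟨hK, hdK⟩ := isImaginaryQuadratic_and_discr_sqrtField_neg_twentyThree
  have hIn : KrizLi2019.InN curve1728a1 (sqrtField (-23)) (r.d : ℤ) :=
    inN_curve1728a1_of_explicit (sqrtField.finrank_eq_two (-23)) hd4 hsq fun ℓ hℓ hℓd => by
      obtain ⟨hbad, -, hj, hev⟩ := hP ℓ hℓ hℓd
      refine ⟨fun e => hbad (by simp [e]), fun e => hbad (by simp [e]), by rw [hdK]; exact hj, ?_⟩
      have e : ((-2 : ℤ) : ZMod ℓ) = -2 := by push_cast; norm_num
      rw [← e]; exact hev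
  exact bsdp_two_of_isIsogenousToKrizLiTwistOfSmallCMBase hKL h33 hS31 hBF hmod hGZK hCassels W'
    (isIsogenousToKrizLiTwistOfSmallCMBase_of_curve1728a1_of_discr_eq hK hdK hSD hIn hd0 hd12 hiso)

/-- **Base `1728v1 : y² = x³ − 2` over `K = ℚ(√−23)`** ((★) CERTIFIED, displayed as `hSD`; additive at `2`):
base data `(−23, 2, [2,3])`. [cite: KrizLi2019, Thm. 5.1 (2), Def. 4.1 and §6 Ex. 6.2]
[cite: CreutzMiller2012, Thm. 1.1] [cite: BurungaleFlach2024, Thm. 1.1 and Cor. 2] [cite: MilneADT2006, Thm. I.7.3] -/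
theorem bsdp_two_of_klCertified_1728v1 (hKL : KrizLi2019.thm112_bsdTwo_twist)
    (h33 : KrizLi2019.thm33_rank_twist) (hS31 : bsdTriple_of_analyticRank_le_one_of_conductor_lt)
    (hBF : bsdTriple_of_hasCM_of_L_one_ne_zero) (hmod : hasEntireLFunction_rat)
    (hGZK : rank_eq_analyticRank_of_analyticRank_le_one) (hCassels : bsdRHS_eq_of_isIsogenous)
    (hSD : HasKrizLiStarDatum curve1728v1 (sqrtField (-23)))
    {rs : List KLRecord} (h : KLCertified rs) :
    ∀ r ∈ rs, r.fieldDisc = -23 → r.cubeConst = 2 → r.badPrimes = [2, 3] →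
      ∀ (W' : WeierstrassCurve ℚ) [W'.IsElliptic] [W'.IsGloballyMinimal],
        (IsIsogenous W' (curve1728v1.quadraticTwist ((r.d : ℤ) : ℚ)) ∨
          IsIsogenous W' (curve1728v1.quadraticTwist ((-23 * (r.d : ℤ) : ℤ) : ℚ))) → BSDp W' 2 := by
  intro r hr hD hc hb W' _ _ hiso
  obtain ⟨hd0, hd12, hd4, hsq, hP⟩ := klExplicit_of_check (h.check_of_mem hr) hD hc hb (by simp)
  obtain ⟨hK, hdK⟩ := isImaginaryQuadratic_and_discr_sqrtField_neg_twentyThree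
  have hIn : KrizLi2019.InN curve1728v1 (sqrtField (-23)) (r.d : ℤ) :=
    inN_curve1728v1_of_explicit (sqrtField.finrank_eq_two (-23)) hd4 hsq fun ℓ hℓ hℓd => by
      obtain ⟨hbad, -, hj, hev⟩ := hP ℓ hℓ hℓd
      refine ⟨fun e => hbad (by simp [e]), fun e => hbad (by simp [e]), by rw [hdK]; exact hj, ?_⟩
      have e : ((2 : ℤ) : ZMod ℓ) = 2 := by push_cast; norm_num
      rw [← e]; exact hev
  exact bsdp_two_of_isIsogenousToKrizLiTwistOfSmallCMBase hKL h33 hS31 hBF hmod hGZK hCassels W'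
    (isIsogenousToKrizLiTwistOfSmallCMBase_of_curve1728v1_of_discr_eq hK hdK hSD hIn hd0 hd12 hiso)


end Summit.BirchSwinnertonDyer.Rank1Residual.P2

end
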